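import Summits.NavierStokesRegularity.FluidComputer.Besov32Clock
import Summits.NavierStokesRegularity.FluidComputer.SobolevLadderSerrin
import Summits.NavierStokesRegularity.FluidComputer.LerayDeadline
import HarnessLib

/-!
# Fluid computer — L56 in its other forms: time-integrated (`L²_t Ḃ^{3/2}_{2,2}`), scale-free product,
# front clock and countdown per level

HONEST FRAMING (cell `pub-fluidc`, verbatim): *low prior, high value-of-information experiment on Tao's
machine paradigm; NOT a claim that NS blows up.* Theorem side of the cell (the level dictionary); nothing here is
evidence of blow-up. Companion of `Besov32Clock` (L56: `ν/(K(T − t)) ≤ Y(t) := ∑_j 8^j ‖Δ̇_j u(t)‖₂²` at every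
`t ∈ (0, T)` along every maximal smooth Leray–Hopf solution of the unforced system on `ℝ³`):

* `besov32_log_floor`, `besov32_lintegral_eq_top` (**L56-S**) — `(ν/K) log((T − t₀)/(T − t)) ≤ ∫_{t₀}^t Y` and
  `∫_{(t₀,T)} Y = ∞`: `u ∉ L²_t(Ḃ^{3/2}_{2,2})_x` on any terminal window — the Prodi–Serrin endpoint `q = 2` of the
  Sobolev–Serrin family L51-S/L52-S (`4/(2s−1) = 2` at `s = 3/2`), in the Hilbert currency;
* `besov32_energy_product` (**L56-P**) — `c ν⁶ ≤ ‖u(t)‖₂⁴ · Y(t)` at every `t ∈ (0, T)` (L56 × Leray's deadline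
  L23; both sides have the dimension of `ν⁶`): the machine is never small in the scale-invariant pairing
  energy² × `Ḃ^{3/2}_{2,2}`-row — the `s = 3/2` member of L51-P/L52-P in the (stronger) ℓ² currency;
* `tsum_eq_low_add_tail`, `besov32_head_le`, `besov32_front_clock`, `besov32_countdown`, `besov32_tail_tendsto_top`
  (**L56″**) — the levels below `J` hold at most `8^J ‖u(0)‖₂²` of the row, so `ν/(K(T−t)) ≤ 8^J‖u(0)‖₂² + ∑_{j≥J} 8^j a_j(t)²`
  at every `t` and `J`; while the row above `J` is within that allowance, `T − t ≥ ν/(2K·8^J‖u(0)‖₂²)` (COUNTDOWN PER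
  LEVEL ∝ `8^{−J}`, the optimal-rate sharpening of L22″); every tail `∑_{j≥J}` tends to `∞` as `t ↑ T`.

0 sorry; no definitions; no named facts (inputs: `Besov32Clock.besov32_clock(_rpow)`, `LerayDeadline.deadline`,
`SobolevLadderSerrin.log_le_lintegral_rpow_of_clock` / `lintegral_rpow_eq_top_of_clock`, the square-function bound
`LPBounds.sq_le`, Leray's energy inequality).

## References

* A. Cheskidov, K. Zaya, J. Math. Phys. 57 (2016) 023101 = arXiv:1503.01784, Thm. 2.4. [CheskidovZaya2016]
* J. Leray, Acta Math. 63 (1934), §34 (6.4) p. 246 (the energy deadline). [Leray1934]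
* G. Prodi, Ann. Mat. Pura Appl. 48 (1959) 173–182 (the `L^q_t L^r_x` scale). [Prodi1959]
-/

noncomputable section

open MeasureTheory Set Function Filter Topology
open scoped ENNReal NNReal
open Literature.Analysis.FluidPDE Literature.Analysis.FunctionSpaces
open Summit.NavierStokesRegularity.FluidComputer.Besov32Clock
open Summit.NavierStokesRegularity.FluidComputer.SobolevLadderSerrin
open Summit.NavierStokesRegularity.FluidComputer.SobolevLadderFront (tendsto_ofReal_clock_top)

namespace Summit.NavierStokesRegularity.FluidComputer.Besov32Forms

/-! ## L56-S: the row time-integrated -/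

/-- **L56-S — LOGARITHMIC FLOOR OF THE RUNNING `L²_t Ḃ^{3/2}_{2,2}` INTEGRAL.** There is an absolute `c > 0` such that
along every maximal smooth solution `(u, p)` of the unforced Navier–Stokes system on `ℝ³ × [0, T)` (`ν > 0`) which is
Leray–Hopf from `u 0`, for all `0 ≤ t₀ ≤ t < T`:
`c · ν · log((T − t₀)/(T − t)) ≤ ∫⁻_{(t₀,t)} ∑_j 8^j ‖Δ̇_j u(τ)‖₂² dτ` (`besov32_clock_rpow` integrated; `c = K⁻¹`).
[cite: CheskidovZaya2016, Thm. 2.4] [cite: Prodi1959] -/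
theorem besov32_log_floor :
    ∃ c : ℝ, 0 < c ∧ ∀ (ν T : ℝ), 0 < ν → 0 < T →
      ∀ (u : ℝ → EuclideanSpace ℝ (Fin 3) → EuclideanSpace ℝ (Fin 3)) (p : ℝ → EuclideanSpace ℝ (Fin 3) → ℝ),
      IsMaximalSmoothSolution ν 0 u p T → IsLerayHopfOn T ν 0 (u 0) u →
      ∀ t₀ t : ℝ, 0 ≤ t₀ → t₀ ≤ t → t < T →
        ENNReal.ofReal (c * ν * Real.log ((T - t₀) / (T - t))) ≤
          ∫⁻ τ in Ioo t₀ t, ∑' j : ℤ, (2 : ℝ≥0∞) ^ ((3 : ℝ) * (j : ℝ)) * blockL2 (u τ) j ^ 2 := by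
  obtain ⟨c, hc, H⟩ := besov32_clock_rpow
  refine ⟨c, hc, fun ν T hν hT u p hmax hLH t₀ t ht₀ h₀ ht => ?_⟩
  have h := log_le_lintegral_rpow_of_clock (a := (1 : ℝ)) (b := (1 : ℝ)) (T := T) hc hν one_pos h₀ ht
    (X := fun τ => ∑' j : ℤ, (2 : ℝ≥0∞) ^ ((3 : ℝ) * (j : ℝ)) * blockL2 (u τ) j ^ 2)
    (fun τ hτ => H ν T hν hT u p hmax hLH τ ⟨ht₀.trans_lt hτ.1, hτ.2.trans ht⟩)
  simpa only [div_one, Real.rpow_one, ENNReal.rpow_one] using h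

/-- **L56-S — THE `L²_t Ḃ^{3/2}_{2,2}` INTEGRAL OVER EVERY TERMINAL WINDOW DIVERGES**: along every maximal smooth
Leray–Hopf solution of the unforced system (`ν > 0`), for every `t₀ ∈ [0, T)`:
`∫⁻_{(t₀,T)} ∑_j 8^j ‖Δ̇_j u(τ)‖₂² dτ = ∞` — `u` leaves `L²_t(Ḃ^{3/2}_{2,2})_x`, the `q = 2` endpoint of the
Sobolev–Serrin family (L51-S: `q = 4/(2s−1)`; compare `∫‖u‖_∞² = ∞`, L30). [cite: CheskidovZaya2016, Thm. 2.4]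
[cite: Prodi1959] -/
theorem besov32_lintegral_eq_top {ν T : ℝ} (hν : 0 < ν) (hT : 0 < T)
    {u : ℝ → EuclideanSpace ℝ (Fin 3) → EuclideanSpace ℝ (Fin 3)} {p : ℝ → EuclideanSpace ℝ (Fin 3) → ℝ}
    (hmax : IsMaximalSmoothSolution ν 0 u p T) (hLH : IsLerayHopfOn T ν 0 (u 0) u)
    {t₀ : ℝ} (ht₀ : t₀ ∈ Ico 0 T) :
    ∫⁻ τ in Ioo t₀ T, ∑' j : ℤ, (2 : ℝ≥0∞) ^ ((3 : ℝ) * (j : ℝ)) * blockL2 (u τ) j ^ 2 = ∞ := by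
  obtain ⟨c, hc, H⟩ := besov32_clock_rpow
  have h := lintegral_rpow_eq_top_of_clock (a := (1 : ℝ)) (b := (1 : ℝ)) hc hν one_pos ht₀.2
    (X := fun τ => ∑' j : ℤ, (2 : ℝ≥0∞) ^ ((3 : ℝ) * (j : ℝ)) * blockL2 (u τ) j ^ 2)
    (fun τ hτ => H ν T hν hT u p hmax hLH τ ⟨ht₀.1.trans_lt hτ.1, hτ.2⟩)
  simpa only [div_one, ENNReal.rpow_one] using h

/-! ## L56-P: the scale-free product with the energy -/

/-- **L56-P — THE SCALE-INVARIANT PRODUCT energy² × `Ḃ^{3/2}_{2,2}`-row.** There is an absolute `c > 0` such that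
along every maximal smooth solution `(u, p)` of the unforced Navier–Stokes system on `ℝ³ × [0, T)` (`ν > 0`) which is
Leray–Hopf from `u 0`, at EVERY `t ∈ (0, T)`: `c · ν⁶ ≤ ‖u(t)‖₂⁴ · ∑_j 8^j ‖Δ̇_j u(t)‖₂²` — L56 (`ν/(K(T−t)) ≤ Y(t)`)
times Leray's deadline L23 (`4c₂ν⁵(T−t) ≤ ‖u(t)‖₂⁴`) cancels `T − t`; both sides have the dimension of `ν⁶`. The
`s = 3/2` member of the product family L51-P/L52-P in the ℓ² currency (its square root `√c ν³ ≤ ‖u‖₂² · Y^{1/2}`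
implies the ℓ¹ one, since `Y^{1/2} ≤ ∑_j 2^{3j/2} a_j`). [cite: CheskidovZaya2016, Thm. 2.4]
[cite: Leray1934, §34 (6.4) p. 246] -/
theorem besov32_energy_product :
    ∃ c : ℝ, 0 < c ∧ ∀ (ν T : ℝ), 0 < ν → 0 < T →
      ∀ (u : ℝ → EuclideanSpace ℝ (Fin 3) → EuclideanSpace ℝ (Fin 3)) (p : ℝ → EuclideanSpace ℝ (Fin 3) → ℝ),
      IsMaximalSmoothSolution ν 0 u p T → IsLerayHopfOn T ν 0 (u 0) u →
      ∀ t ∈ Ioo 0 T,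
        ENNReal.ofReal (c * ν ^ 6) ≤
          eLpNorm (u t) 2 volume ^ 4 * ∑' j : ℤ, (2 : ℝ≥0∞) ^ ((3 : ℝ) * (j : ℝ)) * blockL2 (u t) j ^ 2 := by
  obtain ⟨K, hK, H₁⟩ := besov32_clock
  obtain ⟨c₂, hc₂, H₂⟩ := LerayDeadline.deadline
  refine ⟨4 * c₂ / K, by positivity, fun ν T hν hT u p hmax hLH t ht => ?_⟩
  have hTt : 0 < T - t := sub_pos.2 ht.2
  have hdead := H₂ ν T hν hT u p hmax hLH t ⟨ht.1.le, ht.2⟩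
  have hclock := H₁ ν T hν hT u p hmax hLH t ht
  have hE : eLpNorm (u t) 2 volume ^ 4 = ENNReal.ofReal ((eLpNorm (u t) 2 volume).toReal ^ 4) := by
    rw [ENNReal.ofReal_pow ENNReal.toReal_nonneg,
      ENNReal.ofReal_toReal (hLH.memLp t ⟨ht.1.le, ht.2.le⟩).eLpNorm_ne_top]
  have e : 4 * c₂ / K * ν ^ 6 = (4 * c₂ * ν ^ 5 * (T - t)) * (ν / (K * (T - t))) := by
    field_simp
  calc ENNReal.ofReal (4 * c₂ / K * ν ^ 6)
      = ENNReal.ofReal (4 * c₂ * ν ^ 5 * (T - t)) * ENNReal.ofReal (ν / (K * (T - t))) := by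
        rw [e, ENNReal.ofReal_mul (by positivity)]
    _ ≤ ENNReal.ofReal ((eLpNorm (u t) 2 volume).toReal ^ 4) *
          ∑' j : ℤ, (2 : ℝ≥0∞) ^ ((3 : ℝ) * (j : ℝ)) * blockL2 (u t) j ^ 2 :=
        mul_le_mul' (ENNReal.ofReal_le_ofReal hdead) hclock
    _ = _ := by rw [← hE]

/-! ## L56″: the front clock and the countdown per level -/

/-- A `ℤ`-indexed sum in `ℝ≥0∞` splits at a level `J` into the part below `J` and the tail `∑_{n ≥ 0} f(J + n)`.
[folklore] -/
theorem tsum_eq_low_add_tail (f : ℤ → ℝ≥0∞) (J : ℤ) :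
    ∑' j : ℤ, f j = (∑' j : {j : ℤ // j < J}, f j) + ∑' n : ℕ, f (J + n) := by
  have hsplit := (ENNReal.summable.tsum_add_tsum_compl (s := {j : ℤ | j < J}) (f := f) ENNReal.summable)
  rw [← hsplit]
  congr 1
  let e : ℕ ≃ {j : ℤ // j ∈ ({j : ℤ | j < J} : Set ℤ)ᶜ} :=
    { toFun := fun n => ⟨J + n, by simp⟩
      invFun := fun j => (j.1 - J).toNat
      left_inv := fun n => by simp
      right_inv := fun j => by
        obtain ⟨j, hj⟩ := j
        have hj' : J ≤ j := by
          simp only [mem_compl_iff, mem_setOf_eq, not_lt] at hj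
          exact hj
        refine Subtype.ext ?_
        show J + (((j - J).toNat : ℕ) : ℤ) = j
        rw [Int.toNat_of_nonneg (sub_nonneg.2 hj')]
        ring }
  rw [← e.tsum_eq]
  exact tsum_congr fun n => rfl

/-- **The levels below `J` hold at most `8^J ‖u(0)‖₂²` of the row**: along a maximal smooth Leray–Hopf solution of
the unforced system, for every `t ∈ [0, T)` and every level `J`,
`∑_{j<J} 8^j ‖Δ̇_j u(t)‖₂² ≤ 8^{J−1} · 8‖u(0)‖₂²` (weights `8^j ≤ 8^{J−1}` below `J`, the square-function bound
`∑_l ‖Δ̇_l v‖₂² ≤ 8‖v‖₂²`, Leray's energy inequality). [cite: BahouriCheminDanchin2011, Prop. 2.12] -/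
theorem besov32_head_le {ν T : ℝ} (hν : 0 < ν) (hT : 0 < T)
    {u : ℝ → EuclideanSpace ℝ (Fin 3) → EuclideanSpace ℝ (Fin 3)}
    (hLH : IsLerayHopfOn T ν 0 (u 0) u) {t : ℝ} (ht : t ∈ Ico 0 T) (J : ℤ) :
    ∑' j : {j : ℤ // j < J}, (2 : ℝ≥0∞) ^ ((3 : ℝ) * ((j : ℤ) : ℝ)) * blockL2 (u t) j ^ 2 ≤
      (2 : ℝ≥0∞) ^ ((3 : ℝ) * ((J - 1 : ℤ) : ℝ)) * (8 * eLpNorm (u 0) 2 volume ^ 2) := by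
  set K := lpBounds (Fin 3) with hK
  have hut : MemLp (u t) 2 volume := hLH.memLp t ⟨ht.1, ht.2.le⟩
  have hu0 : MemLp (u 0) 2 volume := hLH.memLp 0 ⟨le_rfl, hT.le⟩
  have hw : ∀ j : {j : ℤ // j < J}, (2 : ℝ≥0∞) ^ ((3 : ℝ) * ((j : ℤ) : ℝ)) ≤
      (2 : ℝ≥0∞) ^ ((3 : ℝ) * ((J - 1 : ℤ) : ℝ)) := fun j => by
    refine ENNReal.rpow_le_rpow_of_exponent_le one_le_two ?_
    have hj : ((j : ℤ) : ℝ) ≤ ((J - 1 : ℤ) : ℝ) := by exact_mod_cast Int.le_sub_one_of_lt j.2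
    linarith
  calc ∑' j : {j : ℤ // j < J}, (2 : ℝ≥0∞) ^ ((3 : ℝ) * ((j : ℤ) : ℝ)) * blockL2 (u t) j ^ 2
      ≤ ∑' j : {j : ℤ // j < J}, (2 : ℝ≥0∞) ^ ((3 : ℝ) * ((J - 1 : ℤ) : ℝ)) * blockL2 (u t) j ^ 2 :=
        ENNReal.tsum_le_tsum fun j => mul_le_mul' (hw j) le_rfl
    _ = (2 : ℝ≥0∞) ^ ((3 : ℝ) * ((J - 1 : ℤ) : ℝ)) * ∑' j : {j : ℤ // j < J}, blockL2 (u t) j ^ 2 :=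
        ENNReal.tsum_mul_left
    _ ≤ (2 : ℝ≥0∞) ^ ((3 : ℝ) * ((J - 1 : ℤ) : ℝ)) * ∑' j : ℤ, blockL2 (u t) j ^ 2 := by
        gcongr
        exact ENNReal.tsum_comp_le_tsum_of_injective Subtype.val_injective (fun j : ℤ => blockL2 (u t) j ^ 2)
    _ ≤ (2 : ℝ≥0∞) ^ ((3 : ℝ) * ((J - 1 : ℤ) : ℝ)) * (8 * eLpNorm (u t) 2 volume ^ 2) := by
        gcongr
        exact K.sq_le (u t) hut
    _ ≤ (2 : ℝ≥0∞) ^ ((3 : ℝ) * ((J - 1 : ℤ) : ℝ)) * (8 * eLpNorm (u 0) 2 volume ^ 2) := by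
        gcongr _ * (8 * ?_)
        exact pow_le_pow_left' (hLH.eLpNorm_le_eLpNorm_datum hν.le hu0 ⟨ht.1, ht.2.le⟩) 2

/-- **L56″ — THE `Ḃ^{3/2}_{2,2}` FRONT CLOCK.** With the constant `K` of `besov32_clock`: along every maximal smooth
Leray–Hopf solution of the unforced system (`ν > 0`), at EVERY `t ∈ (0, T)` and for EVERY level `J`,
`ν/(K(T − t)) ≤ 8^{J−1}·8‖u(0)‖₂² + ∑_{n≥0} 8^{J+n} ‖Δ̇_{J+n} u(t)‖₂²` — the levels below `J` can carry at most
`8^J ‖u(0)‖₂²` of the optimal countdown; the rest must sit at or above `J`. [cite: CheskidovZaya2016, Thm. 2.4]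
[cite: BahouriCheminDanchin2011, Prop. 2.12] -/
theorem besov32_front_clock :
    ∃ K : ℝ, 0 < K ∧ ∀ (ν T : ℝ), 0 < ν → 0 < T →
      ∀ (u : ℝ → EuclideanSpace ℝ (Fin 3) → EuclideanSpace ℝ (Fin 3)) (p : ℝ → EuclideanSpace ℝ (Fin 3) → ℝ),
      IsMaximalSmoothSolution ν 0 u p T → IsLerayHopfOn T ν 0 (u 0) u →
      ∀ t ∈ Ioo 0 T, ∀ J : ℤ,
        ENNReal.ofReal (ν / (K * (T - t))) ≤
          (2 : ℝ≥0∞) ^ ((3 : ℝ) * ((J - 1 : ℤ) : ℝ)) * (8 * eLpNorm (u 0) 2 volume ^ 2) +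
            ∑' n : ℕ, (2 : ℝ≥0∞) ^ ((3 : ℝ) * ((J + n : ℤ) : ℝ)) * blockL2 (u t) (J + n) ^ 2 := by
  obtain ⟨K, hK, H⟩ := besov32_clock
  refine ⟨K, hK, fun ν T hν hT u p hmax hLH t ht J => (H ν T hν hT u p hmax hLH t ht).trans ?_⟩
  rw [tsum_eq_low_add_tail (fun j : ℤ => (2 : ℝ≥0∞) ^ ((3 : ℝ) * (j : ℝ)) * blockL2 (u t) j ^ 2) J]
  exact add_le_add (besov32_head_le hν hT hLH ⟨ht.1.le, ht.2⟩ J) le_rfl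

/-- **L56″ — COUNTDOWN PER LEVEL IN THE `Ḃ^{3/2}_{2,2}` CURRENCY.** With the constant `K` of `besov32_clock`: if at
time `t ∈ (0, T)` the row above level `J` is within the head allowance,
`∑_{n≥0} 8^{J+n} ‖Δ̇_{J+n} u(t)‖₂² ≤ 8^{J−1}·8‖u(0)‖₂²`, then `ν ≤ 2K · 8^{J−1}·8‖u(0)‖₂² · (T − t)`, i.e.
`T − t ≥ ν/(2K · 8^J ‖u(0)‖₂²)`: every unpassed level certifies a remaining time `∝ 8^{−J}` — the rate-optimal
sharpening of the amplitude countdown L22″ (`LeraySupClock`), with no constant other than `K` and the energy.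
[cite: CheskidovZaya2016, Thm. 2.4] -/
theorem besov32_countdown :
    ∃ K : ℝ, 0 < K ∧ ∀ (ν T : ℝ), 0 < ν → 0 < T →
      ∀ (u : ℝ → EuclideanSpace ℝ (Fin 3) → EuclideanSpace ℝ (Fin 3)) (p : ℝ → EuclideanSpace ℝ (Fin 3) → ℝ),
      IsMaximalSmoothSolution ν 0 u p T → IsLerayHopfOn T ν 0 (u 0) u →
      ∀ t ∈ Ioo 0 T, ∀ J : ℤ,
        (∑' n : ℕ, (2 : ℝ≥0∞) ^ ((3 : ℝ) * ((J + n : ℤ) : ℝ)) * blockL2 (u t) (J + n) ^ 2) ≤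
          (2 : ℝ≥0∞) ^ ((3 : ℝ) * ((J - 1 : ℤ) : ℝ)) * (8 * eLpNorm (u 0) 2 volume ^ 2) →
        ν ≤ 2 * K * ((2 : ℝ) ^ ((3 : ℝ) * ((J - 1 : ℤ) : ℝ)) * (8 * (eLpNorm (u 0) 2 volume).toReal ^ 2)) *
          (T - t) := by
  obtain ⟨K, hK, H⟩ := besov32_front_clock
  refine ⟨K, hK, fun ν T hν hT u p hmax hLH t ht J hfront => ?_⟩
  have hTt : 0 < T - t := sub_pos.2 ht.2
  have hu0 : MemLp (u 0) 2 volume := hLH.memLp 0 ⟨le_rfl, hT.le⟩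
  set Hd : ℝ≥0∞ := (2 : ℝ≥0∞) ^ ((3 : ℝ) * ((J - 1 : ℤ) : ℝ)) * (8 * eLpNorm (u 0) 2 volume ^ 2) with hHd
  have hHdtop : Hd ≠ ∞ := ENNReal.mul_ne_top (RiccatiSlice.two_rpow_ne_top _)
    (ENNReal.mul_ne_top (by norm_num) (ENNReal.pow_ne_top hu0.eLpNorm_ne_top))
  have hHdr : Hd.toReal = (2 : ℝ) ^ ((3 : ℝ) * ((J - 1 : ℤ) : ℝ)) * (8 * (eLpNorm (u 0) 2 volume).toReal ^ 2) := by
    rw [hHd, ENNReal.toReal_mul, ENNReal.toReal_mul, ENNReal.toReal_pow, ← ENNReal.toReal_rpow,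
      ENNReal.toReal_ofNat, ENNReal.toReal_ofNat]
  have h1 := (H ν T hν hT u p hmax hLH t ht J).trans (add_le_add le_rfl hfront)
  rw [← two_mul] at h1
  have h2 : ν / (K * (T - t)) ≤ 2 * Hd.toReal := by
    have h3 := ENNReal.toReal_mono (ENNReal.mul_ne_top (by norm_num) hHdtop) h1
    rwa [ENNReal.toReal_ofReal (div_nonneg hν.le (by positivity)), ENNReal.toReal_mul,
      ENNReal.toReal_ofNat] at h3
  rw [div_le_iff₀ (by positivity)] at h2
  rw [← hHdr]
  nlinarith [h2]

/-- **L56″ — EVERY TAIL OF THE `Ḃ^{3/2}_{2,2}` ROW DIVERGES.** Along every maximal smooth Leray–Hopf solution of the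
unforced system (`ν > 0`), for every fixed level `J`: `∑_{n≥0} 8^{J+n} ‖Δ̇_{J+n} u(t)‖₂² → ∞` as `t ↑ T` (the head
below `J` is bounded by `8^J ‖u(0)‖₂²` uniformly in time, the row tends to `∞`). [cite: CheskidovZaya2016, Thm. 2.4] -/
theorem besov32_tail_tendsto_top {ν T : ℝ} (hν : 0 < ν) (hT : 0 < T)
    {u : ℝ → EuclideanSpace ℝ (Fin 3) → EuclideanSpace ℝ (Fin 3)} {p : ℝ → EuclideanSpace ℝ (Fin 3) → ℝ}
    (hmax : IsMaximalSmoothSolution ν 0 u p T) (hLH : IsLerayHopfOn T ν 0 (u 0) u) (J : ℤ) :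
    Tendsto (fun t => ∑' n : ℕ, (2 : ℝ≥0∞) ^ ((3 : ℝ) * ((J + n : ℤ) : ℝ)) * blockL2 (u t) (J + n) ^ 2)
      (𝓝[<] T) (𝓝 ∞) := by
  have hu0 : MemLp (u 0) 2 volume := hLH.memLp 0 ⟨le_rfl, hT.le⟩
  set Hd : ℝ≥0∞ := (2 : ℝ≥0∞) ^ ((3 : ℝ) * ((J - 1 : ℤ) : ℝ)) * (8 * eLpNorm (u 0) 2 volume ^ 2) with hHd
  have hHdtop : Hd ≠ ∞ := ENNReal.mul_ne_top (RiccatiSlice.two_rpow_ne_top _)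
    (ENNReal.mul_ne_top (by norm_num) (ENNReal.pow_ne_top hu0.eLpNorm_ne_top))
  have hY := besov32_tendsto_top hν hT hmax hLH
  -- the row is head + tail with a uniformly bounded head
  have hle : ∀ᶠ t in 𝓝[<] T, ∑' j : ℤ, (2 : ℝ≥0∞) ^ ((3 : ℝ) * (j : ℝ)) * blockL2 (u t) j ^ 2 ≤
      Hd + ∑' n : ℕ, (2 : ℝ≥0∞) ^ ((3 : ℝ) * ((J + n : ℤ) : ℝ)) * blockL2 (u t) (J + n) ^ 2 := by
    filter_upwards [Ioo_mem_nhdsLT hT] with t ht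
    rw [tsum_eq_low_add_tail (fun j : ℤ => (2 : ℝ≥0∞) ^ ((3 : ℝ) * (j : ℝ)) * blockL2 (u t) j ^ 2) J]
    exact add_le_add (besov32_head_le hν hT hLH ⟨ht.1.le, ht.2⟩ J) le_rfl
  -- `Hd + tail → ∞` forces `tail → ∞`
  rw [ENNReal.tendsto_nhds_top_iff_nnreal] at hY ⊢
  intro x
  have hx : ∀ᶠ t in 𝓝[<] T, ((x : ℝ≥0∞) + Hd) < ∑' j : ℤ, (2 : ℝ≥0∞) ^ ((3 : ℝ) * (j : ℝ)) * blockL2 (u t) j ^ 2 := by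
    have h := hY ((x : ℝ≥0∞) + Hd).toNNReal
    rwa [ENNReal.coe_toNNReal (ENNReal.add_ne_top.2 ⟨ENNReal.coe_ne_top, hHdtop⟩)] at h
  filter_upwards [hx, hle] with t h1 h2
  have h3 : (x : ℝ≥0∞) + Hd < Hd + ∑' n : ℕ, (2 : ℝ≥0∞) ^ ((3 : ℝ) * ((J + n : ℤ) : ℝ)) *
      blockL2 (u t) (J + n) ^ 2 := h1.trans_le h2
  rw [add_comm (x : ℝ≥0∞)] at h3
  exact (ENNReal.add_lt_add_iff_left hHdtop).1 h3

end Summit.NavierStokesRegularity.FluidComputer.Besov32Forms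

end
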